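/-
Copyright (c) 2026. All rights reserved.
Released under Apache 2.0 license as described in the file LICENSE.
Authors: abc-iut cell, prover seat abc-iut-w5-d038 (gen 8; row «ARC-MTC-F3» (L4-lead m134), part F3a′, PROOF-ONLY: the
naturality CONDITION of the archimedean `η⊢_{v,ν}` — an orientation cochain for `𝒜` — and its proof at the geometric model).
-/
import Literature.AnabelianGeometry.AbsoluteAnabelian.AutHolFieldFunctorChartSign
import Literature.AnabelianGeometry.AbsoluteAnabelian.ArchimedeanHolFieldFunctorGeometric
import HarnessLib

/-!
# Orientation cochains for `𝒜` — the naturality condition of the archimedean `η⊢_{v,ν}` ([AbsTopIII] Cor 5.10 (iv)(c))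

S. Mochizuki, *Topics in absolute anabelian geometry III*, Cor 5.10 (iv)(c) p. 148 (the natural isomorphism `η⊢_{v,ν}`
between the paths `γ¹_{v,ν}` and `γ⁰_{v,ν}`), Prop 5.8 (iv)/(v) p. 140 (`k∼(G) = C∼ × C∼`, functorial in `TM⊢`: a morphism
acts on BOTH factors by its sign), Def 5.6 (iv) p. 136 (the `TB⊞`-leg pulls back `S¹ × {1}`, `{1} × ℝ_{>0} ⊆ ℂ×` along the
Kummer structure: `𝒜_f` acts by `±1` on the first and TRIVIALLY on the second one-parameter subgroup), Rmk 5.8.1 (i) p. 142.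

THE CONDITION (abc-iut-w5-d038, design note 2026-08-27T02:23Z).  At an archimedean `v` the `γ¹`-side of `η⊢_{v,ν}` acts on
the two one-parameter subgroups of `k∼(G_𝕏)` by `(sign G_f, sign G_f)` (abc-iut-w6-d025's `TMMono.kTildeMap`), the
`γ⁰`-side by `(ε_f, 1)`; a natural isomorphism between them forces the `TM⊢`-signs `sign G_f` of the morphisms of `EA` to be a
COBOUNDARY `b_𝕏 b_𝕐`, and by `sign_toTMMono_map_eq` (`sign G_f = ε_f σ_𝕏 σ_𝕐`, `…ChartSign.lean`) this is the condition
that the TRANSITION SIGNS `ε_f` are a coboundary — «the CAF charts can be re-chosen so that every `𝒜_f` is `ℂ`-linear»: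

The condition is carried as EXPLICIT BINDERS `(c : EA → ℝ) (hc : ∀ 𝕏, c 𝕏 = ±1) (hcob : ∀ f, ε_f = c_𝕏 c_𝕐)` (an
«orientation cochain»; no `Prop`-valued definition is introduced):

* `transitionSign_eq_one_of_cochain` — under a cochain every ENDOMORPHISM has `ε_f = 1`;
  `exists_sign_toTMMono_map_eq_of_cochain` — and the `TM⊢`-signs are the coboundary of `b_𝕏 := c_𝕏 σ_𝕏`;
  `not_exists_cochain_of_sign_endo_eq_neg_one` — a `TM⊢`-sign `−1` on an endomorphism rules every cochain out;
* ★ `HolRS.exists_orientationCochain_geometric Q` — **the GEOMETRIC model `geometricAutHolFieldFunctor Q`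
  (`𝒜_𝕏 = ℂ`, `𝒜_f = id`) HAS an orientation cochain**: `ε_f = c_𝕏 c_𝕐` with `c_𝕏` the orientation (`id` or `conj`,
  `Complex.ringHom_eq_id_or_conj_of_continuous`) of the chosen chart `cafChart 𝕏`.

PROOF-ONLY (no definition, no instance, no named fact).  MODEL-LEVEL; refereed pre-IUT material; nothing here bears on
the disputed [IUTchIII] Cor. 3.12; typed ≠ proved.
-/

set_option autoImplicit false

noncomputable section

open CategoryTheory Complex

universe u

namespace Literature.AnabelianGeometry.AbsoluteAnabelian

namespace AutHolFieldFunctor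

variable {𝔄 : AutHolFieldFunctor.{u}}

/-- Under an ORIENTATION COCHAIN (`c_𝕏 ∈ {±1}` with `ε_f = c_𝕏 c_𝕐` for every `f` — equivalently: after re-choosing the CAF
charts every `𝒜_f` is `ℂ`-linear; the naturality condition of the archimedean `η⊢_{v,ν}`) every ENDOMORPHISM `f : 𝕏 → 𝕏`
has transition sign `+1` (`c_𝕏² = 1`): no object of `EA` has an endomorphism acting on `𝒜_𝕏` by complex conjugation.
[cite: MochizukiAbsTopIII2015, Rmk 5.8.1 (i) p.142] -/
theorem transitionSign_eq_one_of_cochain (c : 𝔄.EA → ℝ) (hc : ∀ X, c X = 1 ∨ c X = -1)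
    (hcob : ∀ {X Y : 𝔄.EA} (f : X ⟶ Y), transitionSign f = c X * c Y) {X : 𝔄.EA} (f : X ⟶ X) :
    transitionSign f = 1 := by
  rw [hcob f]
  rcases hc X with h1 | h1 <;> rw [h1] <;> norm_num

/-- Under an orientation cochain the `TM⊢`-signs of the morphisms of `EA` are the coboundary of `b_𝕏 := c_𝕏 σ_𝕏`
(`sign_toTMMono_map_eq`). [cite: MochizukiAbsTopIII2015, Prop 5.8 (v) p.140] -/
theorem exists_sign_toTMMono_map_eq_of_cochain (c : 𝔄.EA → ℝ) (hc : ∀ X, c X = 1 ∨ c X = -1)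
    (hcob : ∀ {X Y : 𝔄.EA} (f : X ⟶ Y), transitionSign f = c X * c Y) :
    ∃ b : 𝔄.EA → ℝ, (∀ X, b X = 1 ∨ b X = -1) ∧
      ∀ {X Y : 𝔄.EA} (f : X ⟶ Y), TMMono.sign (𝔄.toTMMono.map f) = b X * b Y := by
  refine ⟨fun X => c X * 𝔄.chartSign X, fun X => ?_, fun f => ?_⟩
  · show c X * 𝔄.chartSign X = 1 ∨ c X * 𝔄.chartSign X = -1
    rcases hc X with h1 | h1 <;> rcases 𝔄.chartSign_eq_one_or X with h2 | h2 <;> rw [h1, h2] <;> norm_num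
  · show _ = c _ * 𝔄.chartSign _ * (c _ * 𝔄.chartSign _)
    rw [sign_toTMMono_map_eq, hcob f]
    ring

/-- Conversely, a `TM⊢`-sign `-1` on an endomorphism rules every orientation cochain out.
[cite: MochizukiAbsTopIII2015, Rmk 5.8.1 (i) p.142] -/
theorem not_exists_cochain_of_sign_endo_eq_neg_one {X : 𝔄.EA} (f : X ⟶ X)
    (hf : TMMono.sign (𝔄.toTMMono.map f) = -1) :
    ¬ ∃ c : 𝔄.EA → ℝ, (∀ X, c X = 1 ∨ c X = -1) ∧ ∀ {X Y : 𝔄.EA} (f : X ⟶ Y), transitionSign f = c X * c Y := by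
  rintro ⟨c, hc, hcob⟩
  have h1 := sign_toTMMono_map_eq_transitionSign f
  rw [hf, transitionSign_eq_one_of_cochain c hc hcob f] at h1
  norm_num at h1

end AutHolFieldFunctor

/-! ## The geometric model is orientation coherent -/

namespace HolRS

open AutHolFieldFunctor

/-- A bicontinuous field automorphism `e` of `ℂ` is `id` or `conj`; its ORIENTATION `c(e) ∈ {±1}`. [folklore] -/
private theorem exists_orientation (e : ℂ ≃+* ℂ) (he : Continuous e) :
    ∃ c : ℝ, (c = 1 ∧ ∀ z, e z = z) ∨ (c = -1 ∧ ∀ z, e z = starRingEnd ℂ z) := by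
  rcases Complex.ringHom_eq_id_or_conj_of_continuous (f := e.toRingHom) he with h | h
  · exact ⟨1, Or.inl ⟨rfl, fun z => (RingHom.congr_fun h z : _)⟩⟩
  · exact ⟨-1, Or.inr ⟨rfl, fun z => (RingHom.congr_fun h z : _)⟩⟩

/-- ★ **The geometric model has an orientation cochain.**  For `geometricAutHolFieldFunctor Q` (`𝒜_𝕏 = ℂ`, `𝒜_f = id`, holomorphic
morphisms only) the transition automorphism of `f : 𝕏 → 𝕐` is `e_𝕐 ∘ e_𝕏⁻¹` for the chosen charts `e_𝕏, e_𝕐 ∈ {id, conj}`, so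
`ε_f = c_𝕏 c_𝕐` — the naturality condition of the archimedean `η⊢_{v,ν}` HOLDS here with no hypothesis.
[cite: MochizukiAbsTopIII2015, Cor 5.10 (iv)(c) p.148] -/
theorem exists_orientationCochain_geometric (Q : ObjectProperty HolRS) :
    ∃ c : (geometricAutHolFieldFunctor Q).EA → ℝ, (∀ X, c X = 1 ∨ c X = -1) ∧
      ∀ {X Y : (geometricAutHolFieldFunctor Q).EA} (f : X ⟶ Y), transitionSign f = c X * c Y := by
  classical
  let 𝔄 := geometricAutHolFieldFunctor Q
  -- the orientation of each chosen chart
  have hor : ∀ X : 𝔄.EA, ∃ c : ℝ, (c = 1 ∧ ∀ z, 𝔄.cafChart X z = z) ∨ (c = -1 ∧ ∀ z, 𝔄.cafChart X z = starRingEnd ℂ z) :=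
    fun X => exists_orientation (𝔄.cafChart X) (𝔄.continuous_cafChart X)
  choose c hc using hor
  refine ⟨c, fun X => ?_, fun {X Y} f => ?_⟩
  · rcases hc X with ⟨h, -⟩ | ⟨h, -⟩
    · exact Or.inl h
    · exact Or.inr h
  · -- the transition `e_𝕐 ∘ 𝒜_f ∘ e_𝕏⁻¹ = e_𝕐 ∘ e_𝕏⁻¹` on elements
    have htr : ∀ z : ℂ, transition f z = 𝔄.cafChart Y ((𝔄.cafChart X).symm z) := fun z => rfl
    -- the inverse chart on elements
    have hsymm : ∀ z : ℂ, (𝔄.cafChart X).symm z = (if c X = 1 then z else starRingEnd ℂ z) := by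
      intro z
      rcases hc X with ⟨h1, h⟩ | ⟨h1, h⟩
      · rw [if_pos h1]
        have := h ((𝔄.cafChart X).symm z)
        rw [RingEquiv.apply_symm_apply] at this
        exact this.symm
      · rw [if_neg (by rw [h1]; norm_num)]
        have := h ((𝔄.cafChart X).symm z)
        rw [RingEquiv.apply_symm_apply] at this
        conv_rhs => rw [this, Complex.conj_conj]
    -- is the transition the identity?
    unfold transitionSign
    rcases hc X with ⟨hX, hXz⟩ | ⟨hX, hXz⟩ <;> rcases hc Y with ⟨hY, hYz⟩ | ⟨hY, hYz⟩
    · -- id, id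
      rw [if_pos, hX, hY, one_mul]
      refine RingHom.ext fun z => ?_
      change transition f z = z
      rw [htr, hYz, hsymm, if_pos hX]
    · -- id, conj
      rw [if_neg, hX, hY, one_mul]
      intro habs
      have hz : transition f I = I := RingHom.congr_fun habs I
      rw [htr, hYz, hsymm, if_pos hX, Complex.conj_I] at hz
      have := congrArg Complex.im hz
      norm_num at this
    · -- conj, id
      rw [if_neg, hX, hY, mul_one]
      intro habs
      have hz : transition f I = I := RingHom.congr_fun habs I
      rw [htr, hYz, hsymm, if_neg (by rw [hX]; norm_num), Complex.conj_I] at hz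
      have := congrArg Complex.im hz
      norm_num at this
    · -- conj, conj
      rw [if_pos, hX, hY]
      · norm_num
      refine RingHom.ext fun z => ?_
      change transition f z = z
      rw [htr, hYz, hsymm, if_neg (by rw [hX]; norm_num), Complex.conj_conj]

end HolRS

end Literature.AnabelianGeometry.AbsoluteAnabelian

end
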